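import Literature.Geometry.Kaehler.ComplexTorusHodgeLieAlgebraRatProductHomIntertwiners
import Literature.Geometry.Kaehler.ComplexTorusDivisorClassesEllipticPowerNonCM
import Literature.Algebra.Lie.SemisimpleSmallDimension
import HarnessLib

/-!
# Stable nondegeneracy of `X₁ × X₂` from the RATIONAL Hodge Lie algebras: Moonen–Zarhin's Theorem (3.2)(2) (Hazama) with
# «no factor of type IV» read as `𝒜(X₁) ∩ End⁰(X₁) = 0`, a CM ∕ solvable factor, a CM elliptic factor, and
# «a Hodge-`ℚ`-simple `X₁` with `dim Hg(X₁) ≠ 3` splits off EVERY elliptic curve»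

Layer `Literature/Geometry/Kaehler`, namespace `Literature.Geometry.Kaehler.ComplexTorus`; lane `lit-hodgefound` (Track 2
foundations library), Layer A3/A4; prover seat `lit-hodgefound-p17` (generation 42, self-proposed row g42-#7).  The Hodge-class
consequences of the gen-42 `ℚ`-dictionary: each splitting criterion `Hg(X₁ × X₂)(ℂ) = Hg(X₁)(ℂ) × Hg(X₂)(ℂ)` on the rational Hodge
Lie algebras (g42-#2 `ComplexTorusHodgeLieAlgebraRatProductSolvableFactor`: `X₁` polarised with `𝒜(X₁) ∩ End⁰(X₁) = 0` and `𝒜(X₂)`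
solvable; its CM-elliptic-curve form; g42-#3 `ComplexTorusHodgeLieAlgebraRatProductNoCommonFactor`: `𝒜(X₁)` `ℚ`-simple with a
dimension obstruction) is fed into g37's «split Hodge group + stably nondegenerate factors ⟹ stably nondegenerate product»
(`forall_divisorClasses_powPeriod_prod_eq_hodgeClasses_of_hodgeGroupC_prod_eq`) and, for an elliptic factor, into Tate's
«`Dᵖ(E_τⁿ) = H^{2p}_Hodge(E_τⁿ)` for every elliptic curve» (`divisorClasses_eq_hodgeClasses_ellipticPow`).  STABLY NONDEGENERATE =
Moonen–Zarhin's condition (D): the Hodge classes of every power are generated by divisor classes,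
`∀ k p, divisorClasses (powPeriod Φ k) p = hodgeClasses (powPeriod Φ k) p`.  THEOREMS ONLY (no definition, no instance, no notation,
no named fact; D-0026 net debt 0).

## Sources, verbatim

* B. Moonen, Yu. G. Zarhin [MoonenZarhin1999LowDim], Math. Ann. 315 (1999), held `paper:arxiv-math_9901113`, §3 Theorem (3.2)
  (p0006 L69–L78, "the following result of Hazama"): "Let `X₁` and `X₂` be complex abelian varieties which both satisfy
  condition (D) in (1.·). (1) Suppose `X₁` and `X₂` contain no factors of Type IV. Then `X₁ × X₂` again satisfies (D), and either
  `Hom(X₁, X₂) ≠ 0` or `Hg(X₁ × X₂) = Hg(X₁) × Hg(X₂)`. (2) Suppose `X₁` has no factors of Type IV and `X₂` is of CM-type. Then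
  `X₁ × X₂` again satisfies (D) and `Hg(X₁ × X₂) = Hg(X₁) × Hg(X₂)`."; §3 Lemma (3.6) and Prop. (3.8) (p0007).
* F. Hazama [Hazama1983], Tôhoku Math. J. 35 (1983), Lemma (3.1) (Goursat) and Prop. (2.6).
* B. B. Gordon [Gordon1997], *A survey of the Hodge conjecture for abelian varieties*, §2.16 Proposition, 7.5 Theorem, 7.6.
* H. Lange [Lange2023AbelianVarietiesComplex], *Abelian Varieties over the Complex Numbers* (2023), §7.2.2 Prop. 7.2.5, §7.2.3
  Prop. 7.2.6, §7.3.3 Exercise (3)(a) ("`H^{2p}_Hodge(X) = Dᵖ(X)` for all `p`" for powers of an elliptic curve).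
* J. E. Humphreys [Humphreys1972], §8.4 (no simple Lie algebra of dimension `1`, `2`; dimension `3` only `𝔰𝔩₂`).

## What is proved

* §1 A SOLVABLE ∕ CM FACTOR (Thm. (3.2)(2) over `ℚ`): **`IsRiemannForm.forall_divisorClasses_powPeriod_prod_eq_hodgeClasses_of_forall_mem_endAlgRat_eq_zero_of_isSolvable`**
  (`X₁` polarised, stably nondegenerate, `𝒜(X₁) ∩ End⁰(X₁) = 0`; `𝒜(X₂)` solvable, `X₂` stably nondegenerate ⟹ `X₁ × X₂` stably
  nondegenerate), `…_of_isSemisimple_hodgeGroupLieRat_of_isSolvable`, `…_of_forall_mem_endAlgRat_eq_zero_of_hodgeGroup_comm`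
  (`Hg(X₂)` commutative), `…_of_forall_mem_endAlgRat_eq_zero_of_exists_comm_isReduced_le_endAlgRat` (`X₂` of CM type, Lange 7.2.6 (ii)),
  `IsAbelianVariety.…`.
* §2 A CM ELLIPTIC FACTOR (Prop. (3.8)): **`IsRiemannForm.forall_divisorClasses_powPeriod_prod_ellipticPeriod_eq_hodgeClasses_of_forall_mem_endAlgRat_eq_zero`**
  (`X₁` polarised, stably nondegenerate, `𝒜(X₁) ∩ End⁰(X₁) = 0`, `E_τ` CM ⟹ `X₁ × E_τ` stably nondegenerate),
  `…_of_isSemisimple_hodgeGroupLieRat`.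
* §3 A HODGE-`ℚ`-SIMPLE FACTOR AND AN ELLIPTIC CURVE (arbitrary torus `X₁`): **`hodgeGroupC_prod_ellipticPeriod_eq_blockDiagProd_of_isSimple_of_finrank_ne_three`**
  (`𝒜(X₁)` `ℚ`-simple with `dim_ℚ 𝒜(X₁) ≠ 3` ⟹ `Hg(X₁ × E_τ) = Hg(X₁) × Hg(E_τ)` for EVERY elliptic curve `E_τ`: `dim_ℚ 𝒜(E_τ) ∈ {1, 3}`,
  `dim_ℚ 𝒜(X₁) ≥ 3`, `≠ 3 ⟹ ≥ 6`, and Gordon's graph alternative), `hodgeGroupC_prod_ellipticPeriod_eq_blockDiagProd_of_isSimple_of_ne_bot`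
  (`E_τ` CM: no dimension hypothesis), **`forall_divisorClasses_powPeriod_prod_ellipticPeriod_eq_hodgeClasses_of_isSimple_of_finrank_ne_three`**,
  `forall_divisorClasses_powPeriod_prod_ellipticPeriod_eq_hodgeClasses_of_isSimple_of_ne_bot`,
  `forall_divisorClasses_powPeriod_prod_eq_hodgeClasses_of_isSimple_left_of_finrank_ne` (general `X₂`), and the general
  **`hodgeGroupC_prod_eq_blockDiagProd_of_isSimple_left_of_finrank_lt`** (`𝒜(X₁)` `ℚ`-simple, `dim_ℚ 𝒜(X₂) < dim_ℚ 𝒜(X₁)` ⟹ split)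
  with its right mirror and the two stable-nondegeneracy corollaries, `three_le_finrank_hodgeGroupLieRat_of_isSimple`.
-/

noncomputable section

open Matrix Module Function

namespace Literature.Geometry.Kaehler

namespace ComplexTorus

open Literature.Algebra.Lie

/-- A Lie subalgebra of `𝔤𝔩_ι(R)` (commutator bracket) whose elements commute as matrices is abelian. [folklore] -/
private theorem isLieAbelian_of_forall_mul_comm {ι : Type*} [Fintype ι] [DecidableEq ι] {R : Type*} [CommRing R]
    (K : @LieSubalgebra R (Matrix ι ι R) _ LieRing.ofAssociativeRing LieAlgebra.ofAssociativeAlgebra)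
    (h : ∀ X ∈ K, ∀ Y ∈ K, X * Y = Y * X) : IsLieAbelian K := by
  letI : LieRing (Matrix ι ι R) := LieRing.ofAssociativeRing
  letI : LieAlgebra R (Matrix ι ι R) := LieAlgebra.ofAssociativeAlgebra
  exact ⟨fun X Y ↦ Subtype.ext (by
    rw [LieSubalgebra.coe_bracket, Ring.lie_def, ZeroMemClass.coe_zero, h X.1 X.2 Y.1 Y.2, sub_self])⟩

/-! ### §1 Moonen–Zarhin Thm. (3.2)(2) over `ℚ`: a solvable ∕ CM factor -/

section Solvable

variable {ι₁ ι₂ : Type*} [Fintype ι₁] [Fintype ι₂] [DecidableEq ι₁] [DecidableEq ι₂]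
  {E₁ E₂ : Type*} [NormedAddCommGroup E₁] [NormedSpace ℂ E₁] [NormedAddCommGroup E₂] [NormedSpace ℂ E₂]
  {Φ₁ : (ι₁ → ℝ) ≃L[ℝ] E₁} (Φ₂ : (ι₂ → ℝ) ≃L[ℝ] E₂) {η₁ : E₁ [⋀^Fin 2]→L[ℝ] ℝ}

/-- **MOONEN–ZARHIN THM. (3.2)(2) (HAZAMA) OVER `ℚ`**: `X₁` polarised and stably nondegenerate with `𝒜(X₁) ∩ End⁰(X₁) = 0`
(«no factor of type IV» at the rational Hodge Lie algebra: `𝔷(𝒜(X₁)) = 0`), `𝒜(X₂)` solvable (e.g. `X₂` of CM type) and `X₂` stably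
nondegenerate ⟹ `X₁ × X₂` is stably nondegenerate (through `Hg(X₁ × X₂) = Hg(X₁) × Hg(X₂)`, g42-#2).
[cite: MoonenZarhin1999LowDim, §3 Thm. (3.2)(2) (p0006 L69–L78) and Lemma (3.6)] [cite: Gordon1997, 7.5 Theorem and 7.6] -/
theorem IsRiemannForm.forall_divisorClasses_powPeriod_prod_eq_hodgeClasses_of_forall_mem_endAlgRat_eq_zero_of_isSolvable
    (hη₁ : IsRiemannForm Φ₁ η₁) [LieAlgebra.IsSolvable (hodgeGroupLieRat Φ₂)]
    (h0 : ∀ B ∈ hodgeGroupLieRat Φ₁, B ∈ endAlgRat Φ₁ → B = 0)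
    (hX₁ : ∀ k p, divisorClasses (powPeriod Φ₁ k) p = hodgeClasses (powPeriod Φ₁ k) p)
    (hX₂ : ∀ k p, divisorClasses (powPeriod Φ₂ k) p = hodgeClasses (powPeriod Φ₂ k) p) :
    ∀ k p, divisorClasses (powPeriod (prodPeriod Φ₁ Φ₂) k) p = hodgeClasses (powPeriod (prodPeriod Φ₁ Φ₂) k) p :=
  forall_divisorClasses_powPeriod_prod_eq_hodgeClasses_of_hodgeGroupC_prod_eq
    (hη₁.hodgeGroupC_prod_eq_blockDiagProd_of_forall_mem_endAlgRat_eq_zero_of_isSolvable Φ₂ h0) hX₁ hX₂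

/-- **`𝒜(X₁)` SEMISIMPLE OVER `ℚ`, `𝒜(X₂)` SOLVABLE, both stably nondegenerate ⟹ `X₁ × X₂` stably nondegenerate** (`X₁` polarised).
[cite: MoonenZarhin1999LowDim, §3 Thm. (3.2)(2) (p0006 L69–L78)] [cite: Gordon1997, 7.5 Theorem and 7.6] -/
theorem IsRiemannForm.forall_divisorClasses_powPeriod_prod_eq_hodgeClasses_of_isSemisimple_hodgeGroupLieRat_of_isSolvable
    (hη₁ : IsRiemannForm Φ₁ η₁) [LieAlgebra.IsSemisimple ℚ (hodgeGroupLieRat Φ₁)] [LieAlgebra.IsSolvable (hodgeGroupLieRat Φ₂)]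
    (hX₁ : ∀ k p, divisorClasses (powPeriod Φ₁ k) p = hodgeClasses (powPeriod Φ₁ k) p)
    (hX₂ : ∀ k p, divisorClasses (powPeriod Φ₂ k) p = hodgeClasses (powPeriod Φ₂ k) p) :
    ∀ k p, divisorClasses (powPeriod (prodPeriod Φ₁ Φ₂) k) p = hodgeClasses (powPeriod (prodPeriod Φ₁ Φ₂) k) p :=
  forall_divisorClasses_powPeriod_prod_eq_hodgeClasses_of_hodgeGroupC_prod_eq
    (hη₁.hodgeGroupC_prod_eq_blockDiagProd_of_isSemisimple_hodgeGroupLieRat_of_isSolvable Φ₂) hX₁ hX₂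

variable {Φ₂} in
/-- The same with `X₂` polarised and `Hg(X₂)` COMMUTATIVE (`X₂` of CM type; `𝒜(X₂)` is then abelian, Lange 7.2.6 (i)).
[cite: MoonenZarhin1999LowDim, §3 Thm. (3.2)(2) (p0006 L69–L78)] [cite: Lange2023AbelianVarietiesComplex, §7.2.3 Prop. 7.2.6] -/
theorem IsRiemannForm.forall_divisorClasses_powPeriod_prod_eq_hodgeClasses_of_forall_mem_endAlgRat_eq_zero_of_hodgeGroup_comm
    (hη₁ : IsRiemannForm Φ₁ η₁) {η₂ : E₂ [⋀^Fin 2]→L[ℝ] ℝ} (hη₂ : IsRiemannForm Φ₂ η₂)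
    (hcomm : ∀ M ∈ hodgeGroup Φ₂, ∀ N ∈ hodgeGroup Φ₂, M * N = N * M)
    (h0 : ∀ B ∈ hodgeGroupLieRat Φ₁, B ∈ endAlgRat Φ₁ → B = 0)
    (hX₁ : ∀ k p, divisorClasses (powPeriod Φ₁ k) p = hodgeClasses (powPeriod Φ₁ k) p)
    (hX₂ : ∀ k p, divisorClasses (powPeriod Φ₂ k) p = hodgeClasses (powPeriod Φ₂ k) p) :
    ∀ k p, divisorClasses (powPeriod (prodPeriod Φ₁ Φ₂) k) p = hodgeClasses (powPeriod (prodPeriod Φ₁ Φ₂) k) p := by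
  haveI : IsLieAbelian (hodgeGroupLieRat Φ₂) :=
    isLieAbelian_of_forall_mul_comm _ ((hη₂.hodgeGroupLieRat_comm_iff_hodgeGroup_comm).2 hcomm)
  exact hη₁.forall_divisorClasses_powPeriod_prod_eq_hodgeClasses_of_forall_mem_endAlgRat_eq_zero_of_isSolvable Φ₂ h0 hX₁ hX₂

variable {Φ₂} in
/-- The same with `X₂` polarised OF CM TYPE in Lange's form 7.2.6 (ii): `End⁰(X₂)` contains a commutative semisimple `ℚ`-algebra of
dimension `2 dim X₂`. [cite: MoonenZarhin1999LowDim, §3 Thm. (3.2)(2) (p0006 L69–L78)] [cite: Lange2023AbelianVarietiesComplex, §7.2.3 Prop. 7.2.6] -/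
theorem IsRiemannForm.forall_divisorClasses_powPeriod_prod_eq_hodgeClasses_of_forall_mem_endAlgRat_eq_zero_of_exists_comm_isReduced_le_endAlgRat
    (hη₁ : IsRiemannForm Φ₁ η₁) {η₂ : E₂ [⋀^Fin 2]→L[ℝ] ℝ} (hη₂ : IsRiemannForm Φ₂ η₂)
    (hCM₂ : ∃ T : Subalgebra ℚ (Matrix ι₂ ι₂ ℚ), T ≤ endAlgRat Φ₂ ∧ IsReduced T ∧ (∀ a ∈ T, ∀ b ∈ T, a * b = b * a) ∧
      finrank ℚ T = Fintype.card ι₂)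
    (h0 : ∀ B ∈ hodgeGroupLieRat Φ₁, B ∈ endAlgRat Φ₁ → B = 0)
    (hX₁ : ∀ k p, divisorClasses (powPeriod Φ₁ k) p = hodgeClasses (powPeriod Φ₁ k) p)
    (hX₂ : ∀ k p, divisorClasses (powPeriod Φ₂ k) p = hodgeClasses (powPeriod Φ₂ k) p) :
    ∀ k p, divisorClasses (powPeriod (prodPeriod Φ₁ Φ₂) k) p = hodgeClasses (powPeriod (prodPeriod Φ₁ Φ₂) k) p := by
  haveI : IsLieAbelian (hodgeGroupLieRat Φ₂) :=
    hη₂.isLieAbelian_hodgeGroupLieRat_iff_exists_comm_isReduced_le_endAlgRat.2 hCM₂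
  exact hη₁.forall_divisorClasses_powPeriod_prod_eq_hodgeClasses_of_forall_mem_endAlgRat_eq_zero_of_isSolvable Φ₂ h0 hX₁ hX₂

variable {Φ₂} in
/-- Abelian varieties: `X₁` with `𝒜(X₁) ∩ End⁰(X₁) = 0`, `X₂` of CM type, both stably nondegenerate ⟹ `X₁ × X₂` stably nondegenerate.
[cite: MoonenZarhin1999LowDim, §3 Thm. (3.2)(2) (p0006 L69–L78)] [cite: Lange2023AbelianVarietiesComplex, §7.2.3 Prop. 7.2.6] -/
theorem IsAbelianVariety.forall_divisorClasses_powPeriod_prod_eq_hodgeClasses_of_forall_mem_endAlgRat_eq_zero_of_exists_comm_isReduced_le_endAlgRat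
    (hA₁ : IsAbelianVariety Φ₁) (hA₂ : IsAbelianVariety Φ₂)
    (hCM₂ : ∃ T : Subalgebra ℚ (Matrix ι₂ ι₂ ℚ), T ≤ endAlgRat Φ₂ ∧ IsReduced T ∧ (∀ a ∈ T, ∀ b ∈ T, a * b = b * a) ∧
      finrank ℚ T = Fintype.card ι₂)
    (h0 : ∀ B ∈ hodgeGroupLieRat Φ₁, B ∈ endAlgRat Φ₁ → B = 0)
    (hX₁ : ∀ k p, divisorClasses (powPeriod Φ₁ k) p = hodgeClasses (powPeriod Φ₁ k) p)
    (hX₂ : ∀ k p, divisorClasses (powPeriod Φ₂ k) p = hodgeClasses (powPeriod Φ₂ k) p) :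
    ∀ k p, divisorClasses (powPeriod (prodPeriod Φ₁ Φ₂) k) p = hodgeClasses (powPeriod (prodPeriod Φ₁ Φ₂) k) p := by
  obtain ⟨η₁, hη₁⟩ := hA₁
  obtain ⟨η₂, hη₂⟩ := hA₂
  exact hη₁.forall_divisorClasses_powPeriod_prod_eq_hodgeClasses_of_forall_mem_endAlgRat_eq_zero_of_exists_comm_isReduced_le_endAlgRat
    hη₂ hCM₂ h0 hX₁ hX₂

end Solvable

/-! ### §2 A CM elliptic factor: `X₁ × E_τ` (Moonen–Zarhin Prop. (3.8) + Tate) -/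

section EllipticCM

variable {ι₁ : Type*} [Fintype ι₁] [DecidableEq ι₁] {E₁ : Type*} [NormedAddCommGroup E₁] [NormedSpace ℂ E₁]
  {Φ₁ : (ι₁ → ℝ) ≃L[ℝ] E₁} {η₁ : E₁ [⋀^Fin 2]→L[ℝ] ℝ} {τ : ℂ} (hτ : τ.im ≠ 0)

/-- **`X₁` POLARISED, STABLY NONDEGENERATE, WITH `𝒜(X₁) ∩ End⁰(X₁) = 0`, AND `E_τ` A CM ELLIPTIC CURVE ⟹ `X₁ × E_τ` IS STABLY
NONDEGENERATE** (`Hg(X₁ × E_τ) = Hg(X₁) × Hg(E_τ)` by Prop. (3.8) over `ℚ`, g42-#2; `Dᵖ(E_τⁿ) = H^{2p}_Hodge(E_τⁿ)`, Tate).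
[cite: MoonenZarhin1999LowDim, §3 Prop. (3.8) and Thm. (3.2)(2)] [cite: Lange2023AbelianVarietiesComplex, §7.3.3 Exercise (3)(a)] -/
theorem IsRiemannForm.forall_divisorClasses_powPeriod_prod_ellipticPeriod_eq_hodgeClasses_of_forall_mem_endAlgRat_eq_zero
    (hη₁ : IsRiemannForm Φ₁ η₁) (hCM : ellipticEnd hτ ≠ ⊥) (h0 : ∀ B ∈ hodgeGroupLieRat Φ₁, B ∈ endAlgRat Φ₁ → B = 0)
    (hX₁ : ∀ k p, divisorClasses (powPeriod Φ₁ k) p = hodgeClasses (powPeriod Φ₁ k) p) :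
    ∀ k p, divisorClasses (powPeriod (prodPeriod Φ₁ (ellipticPeriod hτ)) k) p =
      hodgeClasses (powPeriod (prodPeriod Φ₁ (ellipticPeriod hτ)) k) p :=
  forall_divisorClasses_powPeriod_prod_eq_hodgeClasses_of_hodgeGroupC_prod_eq
    (hη₁.hodgeGroupC_prod_ellipticPeriod_eq_blockDiagProd_of_forall_mem_endAlgRat_eq_zero hτ hCM h0) hX₁
    fun k p ↦ divisorClasses_eq_hodgeClasses_ellipticPow hτ k p

/-- `𝒜(X₁)` semisimple over `ℚ` (`X₁` polarised, stably nondegenerate), `E_τ` CM ⟹ `X₁ × E_τ` stably nondegenerate.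
[cite: MoonenZarhin1999LowDim, §3 Prop. (3.8) and Thm. (3.2)(2)] [cite: Lange2023AbelianVarietiesComplex, §7.3.3 Exercise (3)(a)] -/
theorem IsRiemannForm.forall_divisorClasses_powPeriod_prod_ellipticPeriod_eq_hodgeClasses_of_isSemisimple_hodgeGroupLieRat
    (hη₁ : IsRiemannForm Φ₁ η₁) [LieAlgebra.IsSemisimple ℚ (hodgeGroupLieRat Φ₁)] (hCM : ellipticEnd hτ ≠ ⊥)
    (hX₁ : ∀ k p, divisorClasses (powPeriod Φ₁ k) p = hodgeClasses (powPeriod Φ₁ k) p) :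
    ∀ k p, divisorClasses (powPeriod (prodPeriod Φ₁ (ellipticPeriod hτ)) k) p =
      hodgeClasses (powPeriod (prodPeriod Φ₁ (ellipticPeriod hτ)) k) p :=
  hη₁.forall_divisorClasses_powPeriod_prod_ellipticPeriod_eq_hodgeClasses_of_forall_mem_endAlgRat_eq_zero hτ hCM
    (hη₁.isSemisimple_hodgeGroupLieRat_iff_forall_mem_endAlgRat_eq_zero.1 ‹_›) hX₁

end EllipticCM

/-! ### §3 A Hodge-`ℚ`-simple `X₁` with `dim Hg(X₁) ≠ 3` splits off every elliptic curve -/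

section SimpleElliptic

variable {ι₁ ι₂ : Type*} [Fintype ι₁] [Fintype ι₂] [DecidableEq ι₁] [DecidableEq ι₂]
  {E₁ E₂ : Type*} [NormedAddCommGroup E₁] [NormedSpace ℂ E₁] [NormedAddCommGroup E₂] [NormedSpace ℂ E₂]
  (Φ₁ : (ι₁ → ℝ) ≃L[ℝ] E₁) (Φ₂ : (ι₂ → ℝ) ≃L[ℝ] E₂) {τ : ℂ} (hτ : τ.im ≠ 0)

/-- `𝒜(X₁)` `ℚ`-simple, `dim_ℚ 𝒜(X₁ × X₂) ≠ dim_ℚ 𝒜(X₂)`, both stably nondegenerate ⟹ `X₁ × X₂` stably nondegenerate (g42-#3's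
dimension-obstructed graph alternative). [cite: Gordon1997, §2.16 Proposition, 7.5 Theorem and 7.6] [cite: Hazama1983, Lemma (3.1)] -/
theorem forall_divisorClasses_powPeriod_prod_eq_hodgeClasses_of_isSimple_left_of_finrank_ne
    [LieAlgebra.IsSimple ℚ (hodgeGroupLieRat Φ₁)]
    (h : finrank ℚ (hodgeGroupLieRat (prodPeriod Φ₁ Φ₂)) ≠ finrank ℚ (hodgeGroupLieRat Φ₂))
    (hX₁ : ∀ k p, divisorClasses (powPeriod Φ₁ k) p = hodgeClasses (powPeriod Φ₁ k) p)
    (hX₂ : ∀ k p, divisorClasses (powPeriod Φ₂ k) p = hodgeClasses (powPeriod Φ₂ k) p) :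
    ∀ k p, divisorClasses (powPeriod (prodPeriod Φ₁ Φ₂) k) p = hodgeClasses (powPeriod (prodPeriod Φ₁ Φ₂) k) p :=
  forall_divisorClasses_powPeriod_prod_eq_hodgeClasses_of_hodgeGroupC_prod_eq
    (hodgeGroupC_prod_eq_blockDiagProd_of_isSimple_left_of_finrank_ne Φ₁ Φ₂ h) hX₁ hX₂

/-- `𝒜(X₁)` `ℚ`-simple ⟹ `3 ≤ dim_ℚ 𝒜(X₁)`, and `dim_ℚ 𝒜(X₁) ≠ 3 ⟹ 6 ≤ dim_ℚ 𝒜(X₁)` (no semisimple Lie algebra of dimension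
`1, 2, 4, 5` in characteristic `0`). [cite: Humphreys1972, §8.4] -/
theorem three_le_finrank_hodgeGroupLieRat_of_isSimple [LieAlgebra.IsSimple ℚ (hodgeGroupLieRat Φ₁)] :
    3 ≤ finrank ℚ (hodgeGroupLieRat Φ₁) ∧ (finrank ℚ (hodgeGroupLieRat Φ₁) ≠ 3 → 6 ≤ finrank ℚ (hodgeGroupLieRat Φ₁)) := by
  haveI := finite_hodgeGroupLieRat Φ₁
  haveI : Nontrivial (hodgeGroupLieRat Φ₁) :=
    LieModule.nontrivial_of_isIrreducible ℚ (hodgeGroupLieRat Φ₁) (hodgeGroupLieRat Φ₁)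
  exact SemisimpleSmallDimension.three_le_finrank_of_hasTrivialRadical (K := ℚ) (L := hodgeGroupLieRat Φ₁)

/-- **A HODGE-`ℚ`-SIMPLE FACTOR SPLITS OFF EVERY FACTOR WITH A SMALLER HODGE GROUP**: `𝒜(X₁)` `ℚ`-simple and
`dim_ℚ 𝒜(X₂) < dim_ℚ 𝒜(X₁)` (i.e. `dim Hg(X₂) < dim Hg(X₁)`) ⟹ `Hg(X₁ × X₂) = Hg(X₁) × Hg(X₂)` — Gordon's graph alternative
`𝒜(X₁ × X₂) ≅ 𝒜(X₂)` is excluded by `dim_ℚ 𝒜(X₁ × X₂) ≥ dim_ℚ 𝒜(X₁) > dim_ℚ 𝒜(X₂)` (arbitrary tori).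
[cite: Gordon1997, §2.16 Proposition] [cite: Hazama1983, Lemma (3.1)] [cite: MoonenZarhin1999LowDim, §3 (3.1)] -/
theorem hodgeGroupC_prod_eq_blockDiagProd_of_isSimple_left_of_finrank_lt [LieAlgebra.IsSimple ℚ (hodgeGroupLieRat Φ₁)]
    (h : finrank ℚ (hodgeGroupLieRat Φ₂) < finrank ℚ (hodgeGroupLieRat Φ₁)) :
    hodgeGroupC (prodPeriod Φ₁ Φ₂) = blockDiagProd (hodgeGroupC Φ₁) (hodgeGroupC Φ₂) := by
  have hle := finrank_hodgeGroupLieRat_left_le_prod Φ₁ Φ₂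
  exact hodgeGroupC_prod_eq_blockDiagProd_of_isSimple_left_of_finrank_ne Φ₁ Φ₂ (by omega)

/-- Mirror: `𝒜(X₂)` `ℚ`-simple and `dim_ℚ 𝒜(X₁) < dim_ℚ 𝒜(X₂)` ⟹ `Hg(X₁ × X₂) = Hg(X₁) × Hg(X₂)`.
[cite: Gordon1997, §2.16 Proposition] [cite: Hazama1983, Lemma (3.1)] -/
theorem hodgeGroupC_prod_eq_blockDiagProd_of_isSimple_right_of_finrank_lt [LieAlgebra.IsSimple ℚ (hodgeGroupLieRat Φ₂)]
    (h : finrank ℚ (hodgeGroupLieRat Φ₁) < finrank ℚ (hodgeGroupLieRat Φ₂)) :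
    hodgeGroupC (prodPeriod Φ₁ Φ₂) = blockDiagProd (hodgeGroupC Φ₁) (hodgeGroupC Φ₂) := by
  have hle := finrank_hodgeGroupLieRat_right_le_prod Φ₁ Φ₂
  rcases nonempty_lieEquiv_hodgeGroupLieRat_prod_left_or_eq_of_isSimple_right Φ₁ Φ₂ with ⟨⟨e⟩⟩ | hs
  · have := e.toLinearEquiv.finrank_eq
    omega
  · exact hs

/-- `𝒜(X₁)` `ℚ`-simple, `dim_ℚ 𝒜(X₂) < dim_ℚ 𝒜(X₁)`, both stably nondegenerate ⟹ `X₁ × X₂` stably nondegenerate.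
[cite: Gordon1997, §2.16 Proposition, 7.5 Theorem and 7.6] [cite: MoonenZarhin1999LowDim, §3 Thm. (3.2)] -/
theorem forall_divisorClasses_powPeriod_prod_eq_hodgeClasses_of_isSimple_left_of_finrank_lt
    [LieAlgebra.IsSimple ℚ (hodgeGroupLieRat Φ₁)] (h : finrank ℚ (hodgeGroupLieRat Φ₂) < finrank ℚ (hodgeGroupLieRat Φ₁))
    (hX₁ : ∀ k p, divisorClasses (powPeriod Φ₁ k) p = hodgeClasses (powPeriod Φ₁ k) p)
    (hX₂ : ∀ k p, divisorClasses (powPeriod Φ₂ k) p = hodgeClasses (powPeriod Φ₂ k) p) :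
    ∀ k p, divisorClasses (powPeriod (prodPeriod Φ₁ Φ₂) k) p = hodgeClasses (powPeriod (prodPeriod Φ₁ Φ₂) k) p :=
  forall_divisorClasses_powPeriod_prod_eq_hodgeClasses_of_hodgeGroupC_prod_eq
    (hodgeGroupC_prod_eq_blockDiagProd_of_isSimple_left_of_finrank_lt Φ₁ Φ₂ h) hX₁ hX₂

/-- Mirror: `𝒜(X₂)` `ℚ`-simple, `dim_ℚ 𝒜(X₁) < dim_ℚ 𝒜(X₂)`, both stably nondegenerate ⟹ `X₁ × X₂` stably nondegenerate.
[cite: Gordon1997, §2.16 Proposition, 7.5 Theorem and 7.6] [cite: MoonenZarhin1999LowDim, §3 Thm. (3.2)] -/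
theorem forall_divisorClasses_powPeriod_prod_eq_hodgeClasses_of_isSimple_right_of_finrank_lt
    [LieAlgebra.IsSimple ℚ (hodgeGroupLieRat Φ₂)] (h : finrank ℚ (hodgeGroupLieRat Φ₁) < finrank ℚ (hodgeGroupLieRat Φ₂))
    (hX₁ : ∀ k p, divisorClasses (powPeriod Φ₁ k) p = hodgeClasses (powPeriod Φ₁ k) p)
    (hX₂ : ∀ k p, divisorClasses (powPeriod Φ₂ k) p = hodgeClasses (powPeriod Φ₂ k) p) :
    ∀ k p, divisorClasses (powPeriod (prodPeriod Φ₁ Φ₂) k) p = hodgeClasses (powPeriod (prodPeriod Φ₁ Φ₂) k) p :=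
  forall_divisorClasses_powPeriod_prod_eq_hodgeClasses_of_hodgeGroupC_prod_eq
    (hodgeGroupC_prod_eq_blockDiagProd_of_isSimple_right_of_finrank_lt Φ₁ Φ₂ h) hX₁ hX₂

/-- **A HODGE-`ℚ`-SIMPLE `X₁` SPLITS OFF EVERY CM ELLIPTIC CURVE**: `𝒜(X₁)` `ℚ`-simple, `E_τ` CM ⟹ `Hg(X₁ × E_τ) = Hg(X₁) × Hg(E_τ)`
(`dim_ℚ 𝒜(X₁ × E_τ) ≥ dim_ℚ 𝒜(X₁) ≥ 3 > 1 = dim_ℚ 𝒜(E_τ)` excludes the graph alternative `𝒜(X₁ × E_τ) ≅ 𝒜(E_τ)`).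
[cite: Gordon1997, §2.16 Proposition] [cite: MoonenZarhin1999LowDim, §3 Prop. (3.8)] [cite: Humphreys1972, §8.4] -/
theorem hodgeGroupC_prod_ellipticPeriod_eq_blockDiagProd_of_isSimple_of_ne_bot [LieAlgebra.IsSimple ℚ (hodgeGroupLieRat Φ₁)]
    (hCM : ellipticEnd hτ ≠ ⊥) :
    hodgeGroupC (prodPeriod Φ₁ (ellipticPeriod hτ)) = blockDiagProd (hodgeGroupC Φ₁) (hodgeGroupC (ellipticPeriod hτ)) := by
  obtain ⟨h3, -⟩ := three_le_finrank_hodgeGroupLieRat_of_isSimple Φ₁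
  have hle := finrank_hodgeGroupLieRat_left_le_prod Φ₁ (ellipticPeriod hτ)
  refine hodgeGroupC_prod_eq_blockDiagProd_of_isSimple_left_of_finrank_ne Φ₁ (ellipticPeriod hτ) fun heq ↦ ?_
  rw [finrank_hodgeGroupLieRat_ellipticPeriod_of_ne_bot hτ hCM] at heq
  omega

/-- **A HODGE-`ℚ`-SIMPLE `X₁` WITH `dim Hg(X₁) ≠ 3` SPLITS OFF EVERY ELLIPTIC CURVE**: `𝒜(X₁)` `ℚ`-simple, `dim_ℚ 𝒜(X₁) ≠ 3` ⟹
`Hg(X₁ × E_τ) = Hg(X₁) × Hg(E_τ)` for every `τ ∉ ℝ` (`dim_ℚ 𝒜(E_τ) ∈ {1, 3}` while `dim_ℚ 𝒜(X₁ × E_τ) ≥ dim_ℚ 𝒜(X₁) ≥ 6`).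
[cite: Gordon1997, §2.16 Proposition] [cite: Hazama1983, Lemma (3.1)] [cite: Humphreys1972, §8.4] -/
theorem hodgeGroupC_prod_ellipticPeriod_eq_blockDiagProd_of_isSimple_of_finrank_ne_three
    [LieAlgebra.IsSimple ℚ (hodgeGroupLieRat Φ₁)] (h3 : finrank ℚ (hodgeGroupLieRat Φ₁) ≠ 3) :
    hodgeGroupC (prodPeriod Φ₁ (ellipticPeriod hτ)) = blockDiagProd (hodgeGroupC Φ₁) (hodgeGroupC (ellipticPeriod hτ)) := by
  obtain ⟨-, h6⟩ := three_le_finrank_hodgeGroupLieRat_of_isSimple Φ₁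
  have h6' := h6 h3
  have hle := finrank_hodgeGroupLieRat_left_le_prod Φ₁ (ellipticPeriod hτ)
  refine hodgeGroupC_prod_eq_blockDiagProd_of_isSimple_left_of_finrank_ne Φ₁ (ellipticPeriod hτ) fun heq ↦ ?_
  by_cases hE : ellipticEnd hτ = ⊥
  · rw [finrank_hodgeGroupLieRat_ellipticPeriod_of_eq_bot hτ hE] at heq
    omega
  · rw [finrank_hodgeGroupLieRat_ellipticPeriod_of_ne_bot hτ hE] at heq
    omega

/-- **`X₁` STABLY NONDEGENERATE WITH `𝒜(X₁)` `ℚ`-SIMPLE, `E_τ` CM ⟹ `X₁ × E_τ` STABLY NONDEGENERATE** (arbitrary torus `X₁`).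
[cite: MoonenZarhin1999LowDim, §3 Thm. (3.2) and Prop. (3.8)] [cite: Lange2023AbelianVarietiesComplex, §7.3.3 Exercise (3)(a)] [cite: Gordon1997, 7.5 Theorem] -/
theorem forall_divisorClasses_powPeriod_prod_ellipticPeriod_eq_hodgeClasses_of_isSimple_of_ne_bot
    [LieAlgebra.IsSimple ℚ (hodgeGroupLieRat Φ₁)] (hCM : ellipticEnd hτ ≠ ⊥)
    (hX₁ : ∀ k p, divisorClasses (powPeriod Φ₁ k) p = hodgeClasses (powPeriod Φ₁ k) p) :
    ∀ k p, divisorClasses (powPeriod (prodPeriod Φ₁ (ellipticPeriod hτ)) k) p =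
      hodgeClasses (powPeriod (prodPeriod Φ₁ (ellipticPeriod hτ)) k) p :=
  forall_divisorClasses_powPeriod_prod_eq_hodgeClasses_of_hodgeGroupC_prod_eq
    (hodgeGroupC_prod_ellipticPeriod_eq_blockDiagProd_of_isSimple_of_ne_bot Φ₁ hτ hCM) hX₁
    fun k p ↦ divisorClasses_eq_hodgeClasses_ellipticPow hτ k p

/-- **`X₁` STABLY NONDEGENERATE WITH `𝒜(X₁)` `ℚ`-SIMPLE OF DIMENSION `≠ 3` ⟹ `X₁ × E_τ` STABLY NONDEGENERATE FOR EVERY ELLIPTIC CURVE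
`E_τ`** (arbitrary torus `X₁`; Tate's `Dᵖ(E_τⁿ) = H^{2p}_Hodge(E_τⁿ)` for every `E_τ`). [cite: MoonenZarhin1999LowDim, §3 Thm. (3.2)]
[cite: Lange2023AbelianVarietiesComplex, §7.3.3 Exercise (3)(a)] [cite: Gordon1997, §2.16 Proposition and 7.5 Theorem] -/
theorem forall_divisorClasses_powPeriod_prod_ellipticPeriod_eq_hodgeClasses_of_isSimple_of_finrank_ne_three
    [LieAlgebra.IsSimple ℚ (hodgeGroupLieRat Φ₁)] (h3 : finrank ℚ (hodgeGroupLieRat Φ₁) ≠ 3)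
    (hX₁ : ∀ k p, divisorClasses (powPeriod Φ₁ k) p = hodgeClasses (powPeriod Φ₁ k) p) :
    ∀ k p, divisorClasses (powPeriod (prodPeriod Φ₁ (ellipticPeriod hτ)) k) p =
      hodgeClasses (powPeriod (prodPeriod Φ₁ (ellipticPeriod hτ)) k) p :=
  forall_divisorClasses_powPeriod_prod_eq_hodgeClasses_of_hodgeGroupC_prod_eq
    (hodgeGroupC_prod_ellipticPeriod_eq_blockDiagProd_of_isSimple_of_finrank_ne_three Φ₁ hτ h3) hX₁
    fun k p ↦ divisorClasses_eq_hodgeClasses_ellipticPow hτ k p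

end SimpleElliptic

end ComplexTorus

end Literature.Geometry.Kaehler
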